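import Literature.Probability.Percolation.TwoArmNoTouchingMoebius
import Literature.Probability.Percolation.InterfaceLoopPolygon
import HarnessLib

/-!
# Gauge geometry of the faces and edges of `δ𝕋`: signed lattice functionals, low and high faces

Topic: Probability / Percolation (lattice-geometric support). For the interface polygons of
critical site percolation on `δ𝕋` (`IsSiteInterfaceLoop`, `CLE6.lean`; pieces `polyPiece`,
vertices `polyPt = δ · hexCenter`) read against the **hexagonal annuli** `{n ≤ |·|_𝕋 ≤ N}` of the
arm events, the natural radial coordinate is the hexagonal gauge `N = hexGauge`
(`TwoArmScalingLimitFromLoops.lean`: `N(δ v) = δ |v|_𝕋`), whose level sets are the hexagons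
`∂Λ_R`. This file records the elementary gauge geometry used to locate pieces of an interface
polygon relative to the two boundary hexagons of an annulus (input of the sector bookkeeping for
crossing interfaces, `InterfaceSectorLabels.lean`, and of the four-arm colour switching built on
it; S. Smirnov, W. Werner, Math. Res. Lett. 8 (2001), §4: hexagonal annuli `A_+(r, R)`;
M. Aizenman, A. Burchard, Duke Math. J. 99 (1999), App. A: crossing segments of a shell):

* the six signed lattice functionals `X, -X, Y, -Y, X + Y, -(X + Y)` (`signedFun`, integer form
  `signedFunZ` on sites) with the gauge as their maximum (`signedFun_le_hexGauge`,
  `exists_signedFunZ_eq_triNorm`) and unit variation along an edge of `𝕋`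
  (`abs_signedFunZ_sub_le_one_of_adj`, `exists_signedFunZ_ge_of_adj`);
* **`hexGauge_ge_of_mem_segment_of_adj`** — along the segment between two adjacent sites of graph
  norms `≥ m` the gauge stays `≥ δ m` (the two ends share a signed functional
  `≥ m`); `hexGauge_le_of_mem_segment` (`≤ max` at the ends), `hexGauge_le_of_mem_segment_of_le`;
* face centres are centroids (`hexCenter_eq_centroid`, `smul_hexCenter_eq`), so a face with a
  vertex of norm `≤ n - 1` has centre of gauge `≤ δ (n - 1/3)` (`hexGauge_smul_hexCenter_le_of_low`)
  and a face with a vertex of norm `≥ N + 1` has centre with a signed functional `≥ δ (N + 1/3)`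
  (`le_signedFun_smul_hexCenter_of_high`); consequently the pieces of an interface polygon crossing
  an edge with a site of norm `≤ n - 1` stay at gauge `≤ δ (n - 1/3)`
  (`IsSiteInterfaceLoop.hexGauge_le_of_mem_polyPiece_low`) and those crossing an edge whose right
  site has norm `≥ N + 1` stay at gauge `≥ δ (N + 1/3)`
  (`IsSiteInterfaceLoop.le_hexGauge_of_mem_polyPiece_high`).

Everything is proved; no named facts.

## References

* S. Smirnov, W. Werner, Math. Res. Lett. 8 (2001) 729–744, §4 [SmirnovWernerMRL2001].
* M. Aizenman, A. Burchard, Duke Math. J. 99 (1999), Appendix A [AizenmanBurchardDuke1999].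
* F. Camia, C. M. Newman, Comm. Math. Phys. 268 (2006), §4 [CamiaNewman2006].

Tree: `hexGauge`, `triX`, `triY`, `hexGauge_triMeshPoint` (`TwoArmScalingLimitFromLoops.lean`),
`hexGauge_smul_of_nonneg`, `hexGauge_add_le` (`TwoArmNoTouchingMoebius.lean`), `hexCenter`,
`faceVertex`, `hexFaceVertices`, `triMeshPoint`, `polyPt`, `polyPiece`, `IsSiteInterfaceLoop.lv/rv`
(`InterfaceLoopPolygon.lean`). Mathlib: `segment`, `Convex`, `Finset.sum`.
-/

noncomputable section

open Set Metric Complex Filter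
open Literature.Topology.PlaneTopology Literature.Probability.RandomPlanarGeometry
open scoped unitInterval Topology

namespace Literature.Probability.Percolation

open LatticeModels

/-! ### The six signed lattice functionals -/

/-- The six signed lattice functionals `X, -X, Y, -Y, X + Y, -(X + Y)` of the plane, indexed by
`Fin 6`; the gauge is their maximum. [folklore] -/
def signedFun (k : Fin 6) (z : ℂ) : ℝ :=
  ![triX z, -triX z, triY z, -triY z, triX z + triY z, -(triX z + triY z)] k

/-- The signed functionals on sites: `x₀, -x₀, x₁, -x₁, x₀ + x₁, -(x₀ + x₁)`. [folklore] -/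
def signedFunZ (k : Fin 6) (v : Site 2) : ℤ :=
  ![v 0, -v 0, v 1, -v 1, v 0 + v 1, -(v 0 + v 1)] k

/-- Each signed functional is bounded by the gauge. [folklore] -/
theorem signedFun_le_hexGauge (k : Fin 6) (z : ℂ) : signedFun k z ≤ hexGauge z := by
  rw [hexGauge]
  fin_cases k <;> simp only [signedFun]
  · exact (le_abs_self _).trans (le_max_left _ _)
  · exact (neg_le_abs _).trans (le_max_left _ _)
  · exact (le_abs_self _).trans ((le_max_left _ _).trans (le_max_right _ _))
  · exact (neg_le_abs _).trans ((le_max_left _ _).trans (le_max_right _ _))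
  · exact (le_abs_self _).trans ((le_max_right _ _).trans (le_max_right _ _))
  · exact (neg_le_abs _).trans ((le_max_right _ _).trans (le_max_right _ _))

/-- The signed functionals are additive. [folklore] -/
theorem signedFun_add (k : Fin 6) (z w : ℂ) : signedFun k (z + w) = signedFun k z + signedFun k w := by
  fin_cases k <;> simp [signedFun, triX_add, triY_add] <;> ring

/-- The signed functionals are homogeneous. [folklore] -/
theorem signedFun_smul (k : Fin 6) (a : ℝ) (z : ℂ) : signedFun k ((a : ℂ) * z) = a * signedFun k z := by
  fin_cases k <;> simp [signedFun, triX_smul, triY_smul] <;> ring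

/-- The signed functionals at a mesh point: `δ` times the integer functional of the site. [folklore] -/
theorem signedFun_triMeshPoint (k : Fin 6) (δ : ℝ) (v : Site 2) :
    signedFun k (triMeshPoint δ v) = δ * signedFunZ k v := by
  rw [triMeshPoint, signedFun_smul]
  congr 1
  fin_cases k <;> simp [signedFun, signedFunZ, triX_triEmbed, triY_triEmbed]

/-- **The graph norm is attained by a signed functional.** [folklore] -/
theorem exists_signedFunZ_eq_triNorm (v : Site 2) : ∃ k, signedFunZ k v = triNorm v := by
  have h := le_triNorm_iff_lin.1 (le_refl (triNorm v))
  have h' := triNorm_le_iff_lin.1 (le_refl (triNorm v))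
  rcases h with h | h | h | h | h | h
  · exact ⟨0, by simp [signedFunZ]; omega⟩
  · exact ⟨1, by simp [signedFunZ]; omega⟩
  · exact ⟨2, by simp [signedFunZ]; omega⟩
  · exact ⟨3, by simp [signedFunZ]; omega⟩
  · exact ⟨4, by simp [signedFunZ]; omega⟩
  · exact ⟨5, by simp [signedFunZ]; omega⟩

/-- Every signed functional of a site is at most its graph norm. [folklore] -/
theorem signedFunZ_le_triNorm (k : Fin 6) (v : Site 2) : signedFunZ k v ≤ triNorm v := by
  have h' := triNorm_le_iff_lin.1 (le_refl (triNorm v))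
  fin_cases k <;> simp [signedFunZ] <;> omega

/-- **Unit variation along an edge**: a signed functional changes by at most `1` between adjacent
sites. [folklore] -/
theorem abs_signedFunZ_sub_le_one_of_adj (k : Fin 6) {u v : Site 2} (h : triGraph.Adj u v) :
    |signedFunZ k v - signedFunZ k u| ≤ 1 := by
  rw [abs_le]
  rcases (triGraph_adj_iff_coord u v).1 h with h | h | h | h | h | h <;>
    fin_cases k <;> simp [signedFunZ] <;> omega

/-! ### The gauge along segments between neighbouring sites -/

/-- **Two adjacent sites of graph norm `≥ m` share a signed functional `≥ m` at both** (integer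
bookkeeping over the six edge directions). [folklore] -/
theorem exists_signedFunZ_ge_of_adj {u v : Site 2} (h : u = v ∨ triGraph.Adj u v) {m : ℤ}
    (hu : m ≤ triNorm u) (hv : m ≤ triNorm v) : ∃ k, m ≤ signedFunZ k u ∧ m ≤ signedFunZ k v := by
  rcases h with rfl | h
  · obtain ⟨k, hk⟩ := exists_signedFunZ_eq_triNorm u
    exact ⟨k, hk ▸ hu, hk ▸ hu⟩
  have hu' := le_triNorm_iff_lin.1 hu
  have hv' := le_triNorm_iff_lin.1 hv
  have huN := triNorm_le_iff_lin.1 (le_refl (triNorm u))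
  have hvN := triNorm_le_iff_lin.1 (le_refl (triNorm v))
  -- reduce to integer arithmetic over the six directions
  suffices H : (m ≤ u 0 ∧ m ≤ v 0) ∨ (m ≤ -u 0 ∧ m ≤ -v 0) ∨ (m ≤ u 1 ∧ m ≤ v 1) ∨
      (m ≤ -u 1 ∧ m ≤ -v 1) ∨ (m ≤ u 0 + u 1 ∧ m ≤ v 0 + v 1) ∨ (m ≤ -(u 0 + u 1) ∧ m ≤ -(v 0 + v 1)) by
    rcases H with H | H | H | H | H | H
    · exact ⟨0, by simpa [signedFunZ] using H⟩
    · exact ⟨1, by simpa [signedFunZ] using H⟩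
    · exact ⟨2, by simpa [signedFunZ] using H⟩
    · exact ⟨3, by simpa [signedFunZ] using H⟩
    · exact ⟨4, by simpa [signedFunZ] using H⟩
    · exact ⟨5, by simpa [signedFunZ] using H⟩
  rcases (triGraph_adj_iff_coord u v).1 h with h | h | h | h | h | h <;> omega

/-- The gauge of a scaled site is `δ` times its graph norm (`hexGauge_triMeshPoint`, restated with
the cast on the outside). [folklore] -/
theorem hexGauge_triMeshPoint' {δ : ℝ} (hδ : 0 ≤ δ) (v : Site 2) :
    hexGauge (triMeshPoint δ v) = δ * (triNorm v : ℝ) := hexGauge_triMeshPoint hδ v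

/-- **The gauge stays `≥ δ m` on the segment between adjacent sites of graph norms `≥ m`.** [folklore] -/
theorem hexGauge_ge_of_mem_segment_of_adj {δ : ℝ} (hδ : 0 ≤ δ) {u v : Site 2} (h : u = v ∨ triGraph.Adj u v)
    {m : ℤ} (hu : m ≤ triNorm u) (hv : m ≤ triNorm v) {z : ℂ}
    (hz : z ∈ segment ℝ (triMeshPoint δ u) (triMeshPoint δ v)) : δ * m ≤ hexGauge z := by
  obtain ⟨k, hku, hkv⟩ := exists_signedFunZ_ge_of_adj h hu hv
  rw [segment_eq_image_lineMap] at hz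
  obtain ⟨t, ⟨ht0, ht1⟩, rfl⟩ := hz
  refine le_trans ?_ (signedFun_le_hexGauge k _)
  rw [AffineMap.lineMap_apply_module]
  have e : (1 - t) • triMeshPoint δ u + t • triMeshPoint δ v =
      (((1 - t : ℝ) : ℂ) * triMeshPoint δ u) + (((t : ℝ) : ℂ) * triMeshPoint δ v) := by
    simp [Complex.real_smul]
  rw [e, signedFun_add, signedFun_smul, signedFun_smul, signedFun_triMeshPoint, signedFun_triMeshPoint]
  have hku' : (m : ℝ) ≤ signedFunZ k u := by exact_mod_cast hku
  have hkv' : (m : ℝ) ≤ signedFunZ k v := by exact_mod_cast hkv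
  nlinarith [mul_nonneg hδ (sub_nonneg.2 ht1), mul_nonneg hδ ht0]


/-- **The gauge on a segment is at most the larger endpoint gauge** (convexity). [folklore] -/
theorem hexGauge_le_of_mem_segment {a b z : ℂ} (hz : z ∈ segment ℝ a b) : hexGauge z ≤ max (hexGauge a) (hexGauge b) := by
  rw [segment_eq_image_lineMap] at hz
  obtain ⟨t, ⟨ht0, ht1⟩, rfl⟩ := hz
  rw [AffineMap.lineMap_apply_module]
  have e : (1 - t) • a + t • b = (((1 - t : ℝ) : ℂ) * a) + (((t : ℝ) : ℂ) * b) := by simp [Complex.real_smul]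
  rw [e]
  calc hexGauge (((1 - t : ℝ) : ℂ) * a + ((t : ℝ) : ℂ) * b)
      ≤ hexGauge (((1 - t : ℝ) : ℂ) * a) + hexGauge (((t : ℝ) : ℂ) * b) := hexGauge_add_le _ _
    _ = (1 - t) * hexGauge a + t * hexGauge b := by rw [hexGauge_smul_of_nonneg (by linarith), hexGauge_smul_of_nonneg ht0]
    _ ≤ (1 - t) * max (hexGauge a) (hexGauge b) + t * max (hexGauge a) (hexGauge b) :=
        add_le_add (mul_le_mul_of_nonneg_left (le_max_left _ _) (by linarith))
          (mul_le_mul_of_nonneg_left (le_max_right _ _) ht0)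
    _ = max (hexGauge a) (hexGauge b) := by ring

/-- The gauge stays `≤ δ M` on the segment between sites of graph norms `≤ M`. [folklore] -/
theorem hexGauge_le_of_mem_segment_of_le {δ : ℝ} (hδ : 0 ≤ δ) {u v : Site 2} {M : ℤ}
    (hu : triNorm u ≤ M) (hv : triNorm v ≤ M) {z : ℂ}
    (hz : z ∈ segment ℝ (triMeshPoint δ u) (triMeshPoint δ v)) : hexGauge z ≤ δ * M := by
  refine (hexGauge_le_of_mem_segment hz).trans (max_le ?_ ?_)
  · rw [hexGauge_triMeshPoint' hδ]; exact mul_le_mul_of_nonneg_left (by exact_mod_cast hu) hδ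
  · rw [hexGauge_triMeshPoint' hδ]; exact mul_le_mul_of_nonneg_left (by exact_mod_cast hv) hδ


/-! ### Face centres are centroids; the gauge of pieces at the boundary hexagons -/

/-- The vertices of a face, listed. [folklore] -/
theorem mem_hexFaceVertices_iff_exists_faceVertex {F : HexVertex} {v : Site 2} :
    v ∈ hexFaceVertices F ↔ ∃ j : Fin 3, v = faceVertex F j := by
  constructor
  · intro hv
    rcases F with ⟨x, t⟩
    by_cases ht : t = 0
    · subst ht
      rcases mem_hexFaceVertices_zero.1 hv with rfl | rfl | rfl
      · exact ⟨0, by simp [faceVertex]⟩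
      · exact ⟨1, by simp [faceVertex]⟩
      · exact ⟨2, by simp [faceVertex]⟩
    · obtain rfl : t = 1 := by
        rcases Fin.exists_fin_two.1 ⟨t, rfl⟩ with h | h
        · exact (ht h).elim
        · exact h
      rcases mem_hexFaceVertices_one.1 hv with rfl | rfl | rfl
      · exact ⟨0, by simp [faceVertex]⟩
      · exact ⟨2, by simp [faceVertex]⟩
      · exact ⟨1, by simp [faceVertex, add_assoc]⟩
  · rintro ⟨j, rfl⟩; exact faceVertex_mem F j

/-- **The centre of a face is the centroid of its three vertices.** [folklore] -/
theorem hexCenter_eq_centroid (F : HexVertex) :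
    hexCenter F = (triEmbed (faceVertex F 0) + triEmbed (faceVertex F 1) + triEmbed (faceVertex F 2)) / 3 := by
  rcases F with ⟨x, t⟩
  apply triXY_ext
  · rw [triX_hexCenter]
    have e : (triEmbed (faceVertex (x, t) 0) + triEmbed (faceVertex (x, t) 1) + triEmbed (faceVertex (x, t) 2)) / 3 =
        (((1 / 3 : ℝ) : ℂ) * (triEmbed (faceVertex (x, t) 0) + triEmbed (faceVertex (x, t) 1) + triEmbed (faceVertex (x, t) 2))) := by
      push_cast; ring
    rw [e, triX_smul, triX_add, triX_add, triX_triEmbed, triX_triEmbed, triX_triEmbed]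
    by_cases ht : t = 0
    · subst ht; simp [faceVertex]; ring
    · obtain rfl : t = 1 := by
        rcases Fin.exists_fin_two.1 ⟨t, rfl⟩ with h | h
        · exact (ht h).elim
        · exact h
      simp [faceVertex]; ring
  · rw [triY_hexCenter]
    have e : (triEmbed (faceVertex (x, t) 0) + triEmbed (faceVertex (x, t) 1) + triEmbed (faceVertex (x, t) 2)) / 3 =
        (((1 / 3 : ℝ) : ℂ) * (triEmbed (faceVertex (x, t) 0) + triEmbed (faceVertex (x, t) 1) + triEmbed (faceVertex (x, t) 2))) := by
      push_cast; ring
    rw [e, triY_smul, triY_add, triY_add, triY_triEmbed, triY_triEmbed, triY_triEmbed]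
    by_cases ht : t = 0
    · subst ht; simp [faceVertex]; ring
    · obtain rfl : t = 1 := by
        rcases Fin.exists_fin_two.1 ⟨t, rfl⟩ with h | h
        · exact (ht h).elim
        · exact h
      simp [faceVertex]; ring

/-- The scaled centre as a combination of the scaled vertices. [folklore] -/
theorem smul_hexCenter_eq (δ : ℝ) (F : HexVertex) :
    (δ : ℂ) * hexCenter F = ((1 / 3 : ℝ) : ℂ) * (triMeshPoint δ (faceVertex F 0) + triMeshPoint δ (faceVertex F 1) +
      triMeshPoint δ (faceVertex F 2)) := by
  rw [hexCenter_eq_centroid, triMeshPoint, triMeshPoint, triMeshPoint]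
  push_cast
  ring

/-- **The signed functionals of a face centre**: `ℓ(δ · centre F) = δ (ℓ x₀ + ℓ x₁ + ℓ x₂) / 3`.
[folklore] -/
theorem signedFun_smul_hexCenter (k : Fin 6) (δ : ℝ) (F : HexVertex) :
    signedFun k ((δ : ℂ) * hexCenter F) =
      δ * (signedFunZ k (faceVertex F 0) + signedFunZ k (faceVertex F 1) + signedFunZ k (faceVertex F 2)) / 3 := by
  rw [smul_hexCenter_eq, signedFun_smul, signedFun_add, signedFun_add, signedFun_triMeshPoint,
    signedFun_triMeshPoint, signedFun_triMeshPoint]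
  ring

/-- **The gauge of a face centre is at most `δ` times the mean of the vertex norms.** [folklore] -/
theorem hexGauge_smul_hexCenter_le {δ : ℝ} (hδ : 0 ≤ δ) (F : HexVertex) :
    hexGauge ((δ : ℂ) * hexCenter F) ≤
      δ * (triNorm (faceVertex F 0) + triNorm (faceVertex F 1) + triNorm (faceVertex F 2)) / 3 := by
  rw [smul_hexCenter_eq, hexGauge_smul_of_nonneg (by norm_num : (0 : ℝ) ≤ 1 / 3)]
  set a := triMeshPoint δ (faceVertex F 0) with ha
  set b := triMeshPoint δ (faceVertex F 1) with hb
  set c := triMeshPoint δ (faceVertex F 2) with hc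
  have h : hexGauge (a + b + c) ≤ hexGauge a + hexGauge b + hexGauge c :=
    (hexGauge_add_le (a + b) c).trans (by linarith [hexGauge_add_le a b])
  have h1 : hexGauge a = δ * (triNorm (faceVertex F 0) : ℝ) := hexGauge_triMeshPoint' hδ _
  have h2 : hexGauge b = δ * (triNorm (faceVertex F 1) : ℝ) := hexGauge_triMeshPoint' hδ _
  have h3 : hexGauge c = δ * (triNorm (faceVertex F 2) : ℝ) := hexGauge_triMeshPoint' hδ _
  rw [h1, h2, h3] at h
  nlinarith

/-- **A face with a vertex of norm `≤ n - 1` has its centre at gauge `≤ δ (n - 1/3)`** (the other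
vertices are adjacent to it, of norm `≤ n`). [folklore] -/
theorem hexGauge_smul_hexCenter_le_of_low {δ : ℝ} (hδ : 0 ≤ δ) {F : HexVertex} {n : ℤ}
    (h : ∃ v ∈ hexFaceVertices F, triNorm v ≤ n - 1) : hexGauge ((δ : ℂ) * hexCenter F) ≤ δ * (n - 1 / 3) := by
  obtain ⟨v, hv, hvn⟩ := h
  have hle : ∀ j, triNorm (faceVertex F j) ≤ n := fun j ↦ by
    have := triNorm_le_of_mem_hexFaceVertices hv (faceVertex_mem F j); omega
  obtain ⟨j₀, rfl⟩ := mem_hexFaceVertices_iff_exists_faceVertex.1 hv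
  refine (hexGauge_smul_hexCenter_le hδ F).trans ?_
  have hsum : triNorm (faceVertex F 0) + triNorm (faceVertex F 1) + triNorm (faceVertex F 2) ≤ 3 * n - 1 := by
    fin_cases j₀ <;> [have h0 := hvn; have h0 := hvn; have h0 := hvn] <;>
      [have := hle 1; have := hle 0; have := hle 0] <;> [have := hle 2; have := hle 2; have := hle 1] <;>
      simp at h0 <;> omega
  have hsum' : ((triNorm (faceVertex F 0) + triNorm (faceVertex F 1) + triNorm (faceVertex F 2) : ℤ) : ℝ) ≤ 3 * n - 1 := by
    exact_mod_cast hsum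
  push_cast at hsum' ⊢
  nlinarith

/-- **A face with a vertex of norm `≥ N + 1` has its centre at gauge `≥ δ (N + 1/3)`**: the signed
functional attaining that norm is `≥ N` at the two other (adjacent) vertices. More precisely the
functional itself is `≥ δ (N + 1/3)` at the centre. [folklore] -/
theorem le_signedFun_smul_hexCenter_of_high (δ : ℝ) (hδ : 0 ≤ δ) {F : HexVertex} {N : ℤ} {v : Site 2}
    (hv : v ∈ hexFaceVertices F) (hvN : N + 1 ≤ triNorm v) {k : Fin 6} (hk : signedFunZ k v = triNorm v) :
    δ * (N + 1 / 3) ≤ signedFun k ((δ : ℂ) * hexCenter F) := by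
  have hge : ∀ j, N ≤ signedFunZ k (faceVertex F j) := fun j ↦ by
    by_cases hj : faceVertex F j = v
    · rw [hj, hk]; omega
    · have hadj := adj_of_mem_hexFaceVertices hv (faceVertex_mem F j) (Ne.symm hj)
      have := abs_signedFunZ_sub_le_one_of_adj k hadj
      rw [abs_le] at this
      omega
  obtain ⟨j₀, rfl⟩ := mem_hexFaceVertices_iff_exists_faceVertex.1 hv
  have hsum : 3 * N + 1 ≤ signedFunZ k (faceVertex F 0) + signedFunZ k (faceVertex F 1) + signedFunZ k (faceVertex F 2) := by
    have h0 : N + 1 ≤ signedFunZ k (faceVertex F j₀) := by rw [hk]; exact hvN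
    fin_cases j₀ <;> [skip; skip; skip] <;>
      [have := hge 1; have := hge 0; have := hge 0] <;> [have := hge 2; have := hge 2; have := hge 1] <;>
      simp at h0 <;> omega
  have hsum' : ((3 * N + 1 : ℤ) : ℝ) ≤ signedFunZ k (faceVertex F 0) + signedFunZ k (faceVertex F 1) + signedFunZ k (faceVertex F 2) := by
    exact_mod_cast hsum
  rw [signedFun_smul_hexCenter]
  push_cast at hsum' ⊢
  nlinarith

/-- **A signed functional is affine, hence at least its smaller endpoint value on a segment.**
[folklore] -/
theorem le_signedFun_of_mem_segment (k : Fin 6) {a b z : ℂ} (hz : z ∈ segment ℝ a b) {c : ℝ}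
    (ha : c ≤ signedFun k a) (hb : c ≤ signedFun k b) : c ≤ signedFun k z := by
  rw [segment_eq_image_lineMap] at hz
  obtain ⟨t, ⟨ht0, ht1⟩, rfl⟩ := hz
  rw [AffineMap.lineMap_apply_module]
  have e : (1 - t) • a + t • b = (((1 - t : ℝ) : ℂ) * a) + (((t : ℝ) : ℂ) * b) := by simp [Complex.real_smul]
  rw [e, signedFun_add, signedFun_smul, signedFun_smul]
  nlinarith

section Loop

variable {ω : SiteConfig (Site 2)} {f₀ : HexVertex} {w : hexGraph.Walk f₀ f₀} (hw : IsSiteInterfaceLoop ω w)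
  {δ : ℝ} (hδ : 0 < δ)

include hw hδ

/-- **A piece crossing an edge with a site of norm `≤ n - 1` stays at gauge `≤ δ (n - 1/3)`**: both
its end faces contain that site. [folklore] -/
theorem IsSiteInterfaceLoop.hexGauge_le_of_mem_polyPiece_low {i : ℕ} (hi : i < w.length) {n : ℤ}
    (hlow : triNorm (hw.lv i) ≤ n - 1 ∨ triNorm (hw.rv i) ≤ n - 1) {z : ℂ} (hz : z ∈ polyPiece δ w i) :
    hexGauge z ≤ δ * (n - 1 / 3) := by
  have h1 : hexGauge (polyPt δ w i) ≤ δ * (n - 1 / 3) := by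
    refine hexGauge_smul_hexCenter_le_of_low hδ.le ?_
    rcases hlow with h | h
    · exact ⟨hw.lv i, hw.lv_mem_hexFaceVertices hi, h⟩
    · exact ⟨hw.rv i, hw.rv_mem_hexFaceVertices hi, h⟩
  have h2 : hexGauge (polyPt δ w (i + 1)) ≤ δ * (n - 1 / 3) := by
    refine hexGauge_smul_hexCenter_le_of_low hδ.le ?_
    rcases hlow with h | h
    · exact ⟨hw.lv i, hw.lv_mem_hexFaceVertices_succ hi, h⟩
    · exact ⟨hw.rv i, hw.rv_mem_hexFaceVertices_succ hi, h⟩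
  exact (hexGauge_le_of_mem_segment hz).trans (max_le h1 h2)

/-- **A piece crossing an edge whose right site has norm `≥ N + 1` stays at gauge
`≥ δ (N + 1/3)`.** [folklore] -/
theorem IsSiteInterfaceLoop.le_hexGauge_of_mem_polyPiece_high {i : ℕ} (hi : i < w.length) {N : ℤ}
    (hhigh : N + 1 ≤ triNorm (hw.rv i)) {z : ℂ} (hz : z ∈ polyPiece δ w i) : δ * (N + 1 / 3) ≤ hexGauge z := by
  obtain ⟨k, hk⟩ := exists_signedFunZ_eq_triNorm (hw.rv i)
  have h1 := le_signedFun_smul_hexCenter_of_high δ hδ.le (hw.rv_mem_hexFaceVertices hi) hhigh hk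
  have h2 := le_signedFun_smul_hexCenter_of_high δ hδ.le (hw.rv_mem_hexFaceVertices_succ hi) hhigh hk
  exact (le_signedFun_of_mem_segment k hz h1 h2).trans (signedFun_le_hexGauge k z)

end Loop

end Literature.Probability.Percolation
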